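import Mathlib
import HarnessLib
import HarnessLib.Audit
import Summits.QuantumAdvantage.Statement
import Literature.NumberTheory.EllipticCurves.HeightFamily
import Literature.NumberTheory.EllipticCurves.Selmer
import Literature.Computability.Complexity.Randomized
import Literature.Computability.Complexity.BPPErrorReduction
import Literature.Computability.Cryptography.ClassBQP
import HarnessLib.Audit.Status.Attr

/-!
Route: SelmerBand

DORMANT since 2026-08-26T13:38:51Z (reconciler: no traction for 7 d (last activity item-proof-filed at 2026-08-19T13:51:18Z); parked, not closed — `ledger route dormant route-QuantumAdvantage-SelmerBand --off` to reactivate) — unstaffed, not closed; items shared with open routes are served there. `ledger route dormant <id> --off` reactivates.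

# Route SelmerBand — Selmer carries the band — Bhargava–Shankar moments make the prior a theorem
over ℚ

OPERATOR B (adjacent transfer, H⁰ → H¹). The hub's arithmetic-statistics witnesses live in H⁰ (class
groups: ArithStatLadder's 3 ∣ h(−d), LinnikCubicClassGroups, DarkClassGroups), where the prior law
over ℚ is Cohen–Lenstra's OPEN conjecture — so ArithStatLadder's unpredictability crux is typed
without a band and WeilTwice had to leave ℚ for 𝔽_p(t) to make the band a theorem. The adjacent case
in which the analogue of the prior IS a theorem over ℚ itself is one cohomological degree up: the
2-Selmer group Sel₂(E_{A,B}) ⊂ H¹(ℚ, E[2]) of y² = x³ + Ax + B ordered by naive height, where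
Bhargava–Shankar give the first moment (= 3; the limsup half is PROVED in the tree,
`heightAverageLE_card_selmerTwo_holds`) and Bhargava–Shankar–Swaminathan the second (≤ 15). Markov
and Cauchy–Schwarz turn the two moments into a TWO-SIDED density band for the non-parity bit b(A,B)
= [#Sel₂(E_{A,B}) ≤ 2] without knowing the (conjectural, Poonen–Rains) distribution. It suffices to
show X = X_B ∧ X_Q ∧ X_H: X_B (PriorBand) eventually the proportion of curves of height < X with
#Sel₂ ≤ 2 lies in [1/3 − 1/100, 14/15 + 1/100]; X_Q (SelmerMemBQP) the language L = {enc(A,B) :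
(A,B) in the height family, #Sel₂(E_{A,B}) ≤ 2} is in BQP (2-descent = S-units and Cl[2] of the
cubic algebra ℚ[x]/(x³+Ax+B), quantum-polynomial by Hallgren/Biasse–Song); X_H (BeyondConstant,
hypothesis-type, ranked last) no PPT predicts b on the curves of height < X with success more than
1/20 above the best constant rule, infinitely often. The deciding theorem `closes : PriorBand →
SelmerMemBQP → BeyondConstant → QuantumAdvantage` (sorry-free, Sketch.lean rc 0) USES the band: an
amplified BPP decider for L would succeed with probability ≥ 1 − 1/200 on average, beating the
constant rule (capped at 14/15 + 1/100 by X_B) by more than 1/20. Realises witness (I3) of card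
arithmetic-statistics-ladder (routed as ArithStatLadder on its witness I1 only); the band mechanism
and the parity/GRH analysis are the transfer content.
Lean: `(let P : ℤ × ℤ → Prop := fun AB => Nat.card
((Literature.NumberTheory.EllipticCurves.shortWeierstrass AB).selmerGroup 2) ≤ 2; ∀ᶠ X : ℕ in
Filter.atTop, (1 : ℝ) / 3 - 1 / 100 ≤ Literature.NumberTheory.EllipticCurves.heightProportion P X ∧
Literature.NumberTheory.EllipticCurves.heightProportion P X ≤ 14 / 15 + 1 / 100) ∧ (let P : ℤ × ℤ →
Prop := fun AB => Nat.card ((Literature.NumberTheory.EllipticCurves.shortWeierstrass AB).selmerGroup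
2) ≤ 2; let enc : ℤ × ℤ → List Bool := fun AB => Computability.encodeNat (Encodable.encode AB); let
L : Language Bool := enc '' {AB | Literature.NumberTheory.EllipticCurves.IsInHeightFamily AB ∧ P
AB}; L ∈ Literature.Computability.Cryptography.BQP) ∧ (let P : ℤ × ℤ → Prop := fun AB => Nat.card
((Literature.NumberTheory.EllipticCurves.shortWeierstrass AB).selmerGroup 2) ≤ 2; let enc : ℤ × ℤ →
List Bool := fun AB => Computability.encodeNat (Encodable.encode AB); let L : Language Bool := enc
'' {AB | Literature.NumberTheory.EllipticCurves.IsInHeightFamily AB ∧ P AB}; ∀ A :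
Literature.Computability.Complexity.RandAlg (List Bool) Bool, A.IsPolyTime id
Computability.encodeBool → ∃ᶠ X : ℕ in Filter.atTop, (∑ AB ∈
Literature.NumberTheory.EllipticCurves.heightFamilyBelow X, A.pr id (enc AB) {Set.boolIndicator L
(enc AB)}) / ((Literature.NumberTheory.EllipticCurves.heightFamilyBelow X).card : ℝ) ≤ max
(Literature.NumberTheory.EllipticCurves.heightProportion P X) (1 -
Literature.NumberTheory.EllipticCurves.heightProportion P X) + 1 / 20)`

## Assembly
Pure logic plus BPP error reduction (tree theorem `exists_randAlg_error_le_of_mem_BPP_holds`): were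
the summit false, L ∈ BQP (SelmerMemBQP) would be in BPP; amplify to error 1/200, so the decider's
average success over the curves of height < X is ≥ 1 − 1/200 for every X ≥ 5 (the family contains
E_{1,0}); PriorBand caps max(π_X, 1 − π_X) at 14/15 + 1/100 eventually, and BeyondConstant bounds
the average success by that plus 1/20 infinitely often — 0.995 ≤ 0.9934, contradiction. Certified:
`closes` in Sketch.lean / glue.lean, rc 0, axioms propext/Classical.choice/Quot.sound.

Rationale: WHY THIS LINE. The Selmer world has two structures the class-group world lacks over ℚ: (i) moments
that are THEOREMS — avg #Sel₂ = 3 (Bhargava–Shankar, Ann. of Math. 181 (2015) = arXiv:1006.1002, Thm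
1.1; limsup half discharged in the tree) and avg #Sel₂² ≤ 15 (Bhargava–Shankar–Swaminathan,
arXiv:2110.09063, Thm 1.1, READ p. 3), whence by Markov dens{#Sel₂ ≤ 2} ≥ (4 − 3)/3 = 1/3 (PROVED in
the planner sketch: `bandLower_proof`, kernel-closed on propext/choice/Quot.sound) and by
Cauchy–Schwarz dens{#Sel₂ ≥ 4} ≥ (3 − 2)²/15 = 1/15 — a two-sided band with no appeal to
Poonen–Rains; for Cl[3] of quadratic fields Davenport–Heilbronn gives only the upper side and
positive proportion of 3 ∣ h(−d) is open. (ii) A Cassels–Tate parity structure, which is exactly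
what must be AVOIDED: the parity of dim Sel₂ is the root number (Dokchitser–Dokchitser 2010, tree
fact `p_parity`) and w(E_{A,B}) ∈ FP given the factorisation of Δ (Rohrlich/Halberstadt local tables
+ product formula, tree `RootNumber*`), so parity bits collapse into P^FACT and are Shor-dominated —
the H¹ analogue of genus theory (Bosma–Stevenhagen) — while the non-parity bit [#Sel₂ ≤ 2] needs
Cl(K)[2] and units of the cubic 2-division field K, not known to be in P^FACT (Simon 2002
doi:10.1112/S1461157002000688; Schaefer–Stoll 2004 doi:10.1090/S0002-9947-03-03366-X; subexponential
classically). What breaks in the transfer and is typed: membership now carries the GRH issue of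
class-group GENERATION for cubic fields (Hallgren 2005 doi:10.1145/1060590.1060660, Biasse–Song
arXiv:2510.02280 assume Bach bounds) — shared with route LinnikCubicClassGroups' GRH-free line — and
the hypothesis is mildly parity-entangled (under Poonen–Rains a root-number ORACLE would gain ≈ 8 %
over the constant rule, so BeyondConstant(1/20) presupposes that PPTs cannot emulate w, i.e.
factoring-grade parity data). Imported areas: arithmetic statistics / geometry of numbers
(Bhargava–Shankar–Swaminathan), Galois cohomology and descent (Selmer, Cassels, Dokchitser), quantum
algorithms for number fields (Hallgren, EHKS, Biasse–Song); cross-summit reuse of the BSD Literature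
(Selmer.lean, HeightFamily.lean, BSDSelmer.lean, BSDRankZeroDensity.lean). No open route uses an H¹
witness or a moment-sandwich band; the negatives index (SpinorFlattening 1244, CubicStability 2202,
KummerSector 1615, SeparableFrames 9863, ShorLocallyDark 8592, RegulatorThird 15712) is untouched.

RANKED CRUXES. #2 PriorBand (crux) — THE TRANSFERRED THEOREM (load-bearing in `closes`): eventually
in X, the proportion of curves E_{A,B} of naive height < X (one per isomorphism class, the tree's
`heightFamilyBelow`) with #Sel₂(E_{A,B}/ℚ) ≤ 2 lies in [1/3 − 1/100, 14/15 + 1/100]. Proof route: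
BandLower (Markov on the tree's Bhargava–Shankar limsup theorem — PROVED in the sketch) + BandUpper
(Cauchy–Schwarz from AverageGE and SecondMomentLE) + BandGlue. [difficulty: L] (why it might fail:
Only as typed/printed: the Cauchy–Schwarz half needs Bhargava–Shankar's liminf = 3 (uniformity
estimate, Thm 2.13) and BSS's second moment ≤ 15 for exactly this family; and the tree's selmerGroup
must be the classical Sel₂ (bsd.S11 identification facts). The Markov half is kernel-checked.)
[arXiv:1006.1002, arXiv:2110.09063, arXiv:1009.0287]
#3 SelmerMemBQP (crux) — the witness language L = {enc(A,B) : (A,B) ∈ height family ∧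
#Sel₂(E_{A,B}/ℚ) ≤ 2} (enc = encodeNat ∘ Encodable.encode on ℤ × ℤ) is in the tree's strict BQP:
validate (A,B) (p⁴ ∣ A ∧ p⁶ ∣ B test via factoring ∈ FBQP), factor Δ (Shor) to get the bad primes S,
compute E(ℚ)[2], the S-unit group and the 2-torsion of the S-class group of K = ℚ[x]/(x³+Ax+B)
(quantum: Hallgren 2005 constant degree / Biasse–Song), then Sel₂ = {θ ∈ K(S,2) : N(θ) ∈ ℚ*², local
conditions at S ∪ {2, ∞}} by linear algebra over 𝔽₂ (Cassels/Simon 2-descent), and read dim Sel₂ ≤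
1. [difficulty: XL] (why it might fail: Unconditional as typed: the printed quantum class-group
algorithms need Bach-bound generators (GRH); GRH-free generation of Cl(K)[2] for general cubic K is
open (LinnikCubicClassGroups' line; Deuring–Heilbronn leaves one exceptional character). Also
uniform-family typing of the ℝ²×ℤ^k HSP.) [doi:10.1145/1060590.1060660, arXiv:2510.02280,
doi:10.1112/S1461157002000688, doi:10.1090/S0002-9947-03-03366-X, arXiv:1006.1002]
#4 BeyondConstant (crux) — HYPOTHESIS-TYPE CRUX (conjecture-grade; summit strength by
SeparationPrerequisites; refuters first, never a proving target; ranked last): for every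
probabilistic polynomial-time A (tree RandAlg, IsPolyTime) there are infinitely many X at which A's
average probability, over the curves of naive height < X, of correctly predicting "enc(A,B) ∈ L" is
at most max(π_X, 1 − π_X) + 1/20, π_X the proportion with #Sel₂ ≤ 2 — no efficient statistic beats
the constant rule by five percent. Typable relative to the prior because PriorBand is a theorem;
1/20 is the weakest margin the certified band allows (anything below 1/15 − 1/100). [deps:
PriorBand] [difficulty: open-problem] (why it might fail: False if a PPT beats the constant rule by
5 %: a class-group-free 2-descent, a poly-time L-value/modular-symbol method, or — under
Poonen–Rains — a PPT emulating the root number of random E_(A,B) to ≈97 % (a w-ORACLE gains ≈8 %),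
which needs factoring-grade parity data (Rohrlich + Dokchitser).) [arXiv:1009.0287, arXiv:1006.1002,
arXiv:math/0610290, Literature.Barriers.QuantumAdvantage.SeparationPrerequisites]
#9 BandLower (support) — the Markov half of the band, PROVABLE NOW and in fact PROVED in the
planner's Sketch.lean (`bandLower_proof`, kernel-closed): from the tree's
`heightAverageLE_card_selmerTwo_holds` (limsup of the average of #Sel₂ ≤ 3) and #Sel₂ = 2^s on the
family (`exists_natCard_selmerGroup_eq_pow`), the lower density of {#Sel₂ ≤ 2} is ≥ 1/3 (4 −
3·1_{≤2} ≤ #Sel₂ pointwise). [difficulty: provable-now] [arXiv:1006.1002,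
Literature.NumberTheory.EllipticCurves.heightAverageLE_card_selmerTwo_holds]
#9 AverageGE (support) — NAMED-FACT-TYPE (Bhargava–Shankar, Ann. of Math. 181 (2015), Thm 1.1, the
liminf half "the average IS 3", via the uniformity estimate Thm 2.13; the tree's named fact
`average_card_selmerTwo` in Tendsto form implies it): for every ε > 0, eventually the height-average
of #Sel₂ is ≥ 3 − ε. [difficulty: L] [arXiv:1006.1002,
Literature.NumberTheory.EllipticCurves.average_card_selmerTwo]
#9 SecondMomentLE (support) — NAMED-FACT-TYPE (Bhargava–Shankar–Swaminathan, arXiv:2110.09063, Thm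
1.1, READ: "the second moment of the size of the 2-Selmer group is at most 15", same family and
height): limsup of the height-average of (#Sel₂)² is ≤ 15, in the tree's HeightAverageLE form.
[difficulty: L] [arXiv:2110.09063]
#9 BandUpper (support) — the Cauchy–Schwarz half, PROVABLE NOW (finite sums): AverageGE and
SecondMomentLE give lower density ≥ 1/15 for {#Sel₂ ≥ 4} = {¬ #Sel₂ ≤ 2}: with q = proportion of
#Sel₂ ≥ 4, avg(#Sel₂·1_{≥4}) ≥ (3 − ε) − 2 and (avg(#Sel₂·1_{≥4}))² ≤ avg(#Sel₂²)·q ≤ (15 + ε) q.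
[difficulty: provable-now] [arXiv:2110.09063, arXiv:1006.1002]
#9 BandGlue (support) — glue of the band, PROVABLE NOW: HeightDensityGE P (1/3) and HeightDensityGE
¬P (1/15) give PriorBand (the two proportions sum to 1 on a nonempty family; take ε = 1/100).
[difficulty: provable-now] [arXiv:1006.1002]

TWO-LAYER PLAN. PriorBand ⇐ BandLower (done) → BandUpper → BandGlue → PriorBand (k = 3, depth 1; all
supports filed now). SelmerMemBQP ⇐ SelmerGRH (GrandRiemannHypothesisGL → SelmerMemBQP: 2-descent +
Hallgren/Biasse–Song under Bach bounds, provable from print) and SelmerGRHFree (GRH-free generation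
of Cl(K)[2] for cubic K by random large factor bases — LinnikCubicClassGroups' Linnik–Stark line
transplanted from pure to general cubics) → SelmerMemBQP (k = 2), filed once a prover picks the
membership crux.

KILL CRITERIA. BeyondConstant REFUTED by an explicit PPT statistic (class-group-free descent,
analytic method, or a cheap root-number emulator beating the constant rule by 5 %) ⇒ close
refuted:BeyondConstant; if the refuter is root-number-based only (parity leak, the non-parity
residue still hard) the witness survives but the band is no longer load-bearing ⇒ supersede by an
ArithStat-style HeurBPP typing or retire. A proof that Cl(K)[2] of cubic fields (hence Sel₂) is in
P^FACT ⇒ the witness is Shor-dominated ⇒ close superseded (by Shor's banked bridge). PriorBand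
refuted AS TYPED ⇒ re-type once (constants/junk values), not twice. SelmerMemBQP shown to REQUIRE
GRH-strength input ⇒ declare the route conditional on GrandRiemannHypothesisGL (route edit), do not
retire.

NOT DECOMPOSED YET. The GRH split of SelmerMemBQP (conditional support + GRH-free crux) — waits for
a prover's reading of Hallgren 2005 §4 vs the tree's HallgrenClassGroup* files; the uniform-family
typing of the cubic-field HSP (shared machinery with ArithStatLadder/LinnikCubic); correlation RUNGS
(AC⁰ etc.) are deliberately NOT claimed: Bhargava–Shankar equidistribution holds only in congruence
families with fixed moduli, far from the short-progression regime an AC⁰ rung needs. PARITY SHADOW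
(rev 1, cone repair 2026-08-16): the former support item RootNumberShadowFP — "(A, B, prime
factorisation of |4A³ + 27B²|) ↦ [w(E_{A,B}) = +1] is polynomial-time" (product formula
`rootNumber_eq_algebraicRootNumber` + Rohrlich's local formula at p ≥ 5 and Halberstadt's tables at
2, 3; doi:10.1007/BF01231283, arXiv:math/0610290) — is EXPLANATORY (it records why the witness is
the NON-parity bit [#Sel₂ ≤ 2] rather than the root number) and not load-bearing: `closes` uses
exactly PriorBand, SelmerMemBQP, BeyondConstant. It was dropped as an item because its statement
forced `import Literature.NumberTheory.EllipticCurves.RootNumber`, whose closure carries the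
modularity-grade named facts `WeierstrassCurve.nonempty_completedLContinuations`,
`WeierstrassCurve.rootNumber_eq_algebraicRootNumber`,
`WeierstrassCurve.hasFunctionalEquationSign_rootNumber`, `WeierstrassCurve.even_analyticRank_iff`,
`WeierstrassCurve.hasEntireLFunction_rat` (XL, unproved) into the route's import cone and kept the
route unstaffed, while no item needs any of them (the remaining imports HeightFamily / Selmer /
Randomized / BPPErrorReduction / ClassBQP have every named fact in their closure discharged:
finite_selmerGroup_holds, exists_kummerMap_holds, module_finite_point_holds, …). A refuter attacking
BeyondConstant through the parity leak, or a prover wanting the shadow theorem, states it in its own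
Theorems file with its own imports (`--supports` BeyondConstant); it needs no route item.

CHEAPEST FALSIFIER. (1) Lookup, done: BSS Thm 1.1 READ (arXiv:2110.09063 p. 3: "at most 15", same
family); BS Thm 1.1 is equality (= 3). (2) In-Lean, done: BandLower PROVED (Sketch.lean
`bandLower_proof`, rc 0, no sorry) — the Markov half of the band is a theorem of the tree today. (3)
Data (a refuter's first kit job, not run here): pari `ellrank`/2-descent on ~10⁵ random (A,B) of
height ≤ 10¹²: empirical density of #Sel₂ ≤ 2 (Poonen–Rains predicts ≈ 0.63 ∈ [1/3, 14/15]) and the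
advantage over the constant rule of the best classifier on CHEAP features (A, B mod small primes,
sign and size of Δ, small-prime local root numbers): BeyondConstant(1/20) predicts < 5 %; a w-oracle
(needs factoring) is predicted to reach ≈ 8 %.

NUMBERS. avg #Sel₂ = 3, avg #Sel₂² ≤ 15 (Poonen–Rains: = 15), avg #Sel₃ = 4, avg #Sel₅ = 6
(Bhargava–Shankar); Poonen–Rains masses for p = 2: P(s=0,1,2,3,4) ≈ 0.2097, 0.4194, 0.2796, 0.0799,
0.0107, so π = P(s ≤ 1) ≈ 0.629 (inside the certified band [0.333, 0.933]); certified margins: 1/3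
(Markov), 1/15 (Cauchy–Schwarz), hypothesis margin 1/20; parity leak under PR: best w-measurable
rule 0.710 vs constant 0.629 (+0.081).

DEFINITION REQUESTS. None: every object is in the tree (WeierstrassCurve.selmerGroup,
shortWeierstrass, heightFamilyBelow/heightProportion, RandAlg, BQP). Cite facts wanted later by
provers: BSS Thm 1.1 (arXiv:2110.09063) as a Literature named fact next to
`heightAverageLE_card_selmerTwo`; Simon 2002 / Schaefer–Stoll 2004 2-descent correctness; Hallgren
2005 constant-degree class group under GRH (tree has the quadratic instance
`Hallgren2005_classNumber_qsolvable_of_GRH`).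

Novelty: Searches (2026-08-16): hub — all 39 open + 5 closed-tonight route headers (levers listed in NOTES),
Ideas index 29 open + 172 closed (hits: card arithmetic-statistics-ladder item (I3) "2-Selmer rank …
average |Sel₂| = 3 PROVED; s₂ ∈ FBQP^GRH; parity ∈ P^FACT" — the witness family, unrouted;
two-cohomologies-transfer (closed dup) names Selmer/descent as cross-summit bridge only); grep of
Theses for Selmer/Bhargava/descent/root number (ArithStatLadder uses DH/BST/Bhargava–Varma FIRST
moments for cubic-field counts; no Selmer item anywhere); `lit search --source arxiv` ×8 ("quantum
algorithm Selmer group elliptic curve", "quantum Selmer", "quantum algorithm rank elliptic curve",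
"Mordell-Weil quantum descent", "second moment 2-Selmer Bhargava Shankar Swaminathan" → 2110.09063
READ, "quantum algorithms number fields S-units applications" → 2510.02280 READ (no Selmer
application), "Eisentrager Hallgren Kitaev Song", "Biasse Song class group") → 0 rows on
quantum+Selmer; `lit galaxy search "quantum algorithm Selmer" --star all` → 0; `lit frontier
QuantumAdvantage --since 2023` (30 rows, none arithmetic-statistical); OpenAlex/S2 rate-limited this
session (noted). Tree: Literature/NumberTheory/EllipticCurves (Selmer, BhargavaShankar*,
BSDRankZeroDensity, RootNumber) read for the exact typed objects.
Nearest prior art found: card arithmetic-statistics-ladder (I3) (hub; names the 2-Selmer witness,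
its GRH-membership and the parity shadow, no band, no route); route WeilTwice (hub; same  [refs: 10.1145/1060590.1060660, 1006.1002, 2110.09063, 1009.0287, doi:10.1145/1060590.1060660]

Barriers (technique_class: adjacent-transfer, arithmetic-statistics, average-case): - technique_class: adjacent-transfer, arithmetic-statistics, average-case (also:
galois-cohomology/descent, quantum-algorithm)
- Literature.Barriers.QuantumAdvantage.SeparationPrerequisites: APPLIES and is CONFINED to the
hypothesis-type crux BeyondConstant (with SelmerMemBQP it yields BQP ⊄ BPP and, since "#Sel₂ ≥ 4"
has NP certificates — two independent locally soluble 2-coverings — NP-type consequences); PriorBand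
and all supports are theorems of arithmetic statistics, SelmerMemBQP a published algorithm modulo
GRH.
- Literature.Barriers.QuantumAdvantage.RandomOracleMethod: not engaged — "average-case" here means
the natural height-ordered family of explicit curves E_(A,B), not an oracle distribution; no
random/unstructured oracle, no Bennett–Gill-type measure-one claim, and no evidence for or against
the summit is drawn from oracle worlds; the hardness hypothesis is about a white-box arithmetic
function whose quantum algorithm uses certified structure (period lattices of S-unit groups), i.e.
exactly the STRUCTURED regime the random-oracle method says nothing about.
- Literature.Barriers.QuantumAdvantage.TotalFunctionSpeedupLimit: not engaged — the barrier bounds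
quantum QUERY speedups for total Boolean functions of a black-box input (D ≤ O(Q⁴), ABKRT); here the
input (A, B) is read in full by both machines and the quantum advantage is in TIME, coming from
period finding on number-theoretically certified lattices (S-unit groups, class groups: periodic by
theorem, Shor/Hallg

History (route lifecycle, newest last):
- 2026-08-16T22:33:37Z · rev 1: dropped RootNumberShadowFP — cone repair (unit rrepair-QuantumAdvantage-SelmerBand-0dacacfc): drop support RootNumberShadowFP (explanatory parity-shadow item, untouched by closes) and the i (planner-rrepair-QuantumAdvantage-SelmerBand-0dacacfc-0)
- 2026-08-26T13:38:51Z · DORMANT — reconciler: no traction for 7 d (last activity item-proof-filed at 2026-08-19T13:51:18Z); parked, not closed — `ledger route dormant route-QuantumAdvantage-Selm (operator:999:3081930)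

sub-problem: QuantumAdvantage · status: dormant · opened planner-plan-novel-QuantumAdvantage-QuantumAdva-e0108269-b-v2-g11-0 2026-08-16T22:23:19Z · rev 1 · ledger route-QuantumAdvantage-SelmerBand
GENERATED by the gate from the ledger (D-0016/17). Provers cite these decls: `theorem foo : Summit.QuantumAdvantage.QuantumAdvantage.Theses.SelmerBand.<Decl> := …` in Summits/QuantumAdvantage/QuantumAdvantage/Theorems/<Name>.lean.
-/

namespace Summit.QuantumAdvantage.QuantumAdvantage.Theses.SelmerBand

open scoped BigOperators Topology Manifold Classical MeasureTheory ProbabilityTheory Matrix InnerProductSpace ComplexConjugate ContinuousMap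
open Filter Set Function TopologicalSpace MeasureTheory

attribute [summit_statement] _root_.QuantumAdvantage

open Literature.QuantumAdvantage

/-- item stmt-QuantumAdvantage-17066 · crux · rank 2 · open · by planner
why it might fail: Only as typed/printed: the Cauchy–Schwarz half needs Bhargava–Shankar's liminf = 3 (uniformity estimate, Thm 2.13) and BSS's second moment ≤ 15 for exactly this family; and the tree's selmerGroup must be the classical Sel₂ (bsd.S11 identification facts). The Markov half is kernel-checked.
sources: arXiv:1006.1002, arXiv:2110.09063, arXiv:1009.0287
[crux] THE TRANSFERRED THEOREM (load-bearing in `closes`): eventually in X, the proportion of curves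
E_{A,B} of naive height < X (one per isomorphism class, the tree's `heightFamilyBelow`) with
#Sel₂(E_{A,B}/ℚ) ≤ 2 lies in [1/3 − 1/100, 14/15 + 1/100]. Proof route: BandLower (Markov on the
tree's Bhargava–Shankar limsup theorem — PROVED in the sketch) + BandUpper (Cauchy–Schwarz from
AverageGE and SecondMomentLE) + BandGlue. [difficulty: L] -/
@[route_item "route-QuantumAdvantage-SelmerBand", crux]
def PriorBand : Prop :=
  let P : ℤ × ℤ → Prop := fun AB => Nat.card ((Literature.NumberTheory.EllipticCurves.shortWeierstrass AB).selmerGroup 2) ≤ 2; ∀ᶠ X : ℕ in Filter.atTop, (1 : ℝ) / 3 - 1 / 100 ≤ Literature.NumberTheory.EllipticCurves.heightProportion P X ∧ Literature.NumberTheory.EllipticCurves.heightProportion P X ≤ 14 / 15 + 1 / 100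

/-- item stmt-QuantumAdvantage-17067 · crux · rank 3 · open · by planner
why it might fail: Unconditional as typed: the printed quantum class-group algorithms need Bach-bound generators (GRH); GRH-free generation of Cl(K)[2] for general cubic K is open (LinnikCubicClassGroups' line; Deuring–Heilbronn leaves one exceptional character). Also uniform-family typing of the ℝ²×ℤ^k HSP.
sources: doi:10.1145/1060590.1060660, arXiv:2510.02280, doi:10.1112/S1461157002000688, doi:10.1090/S0002-9947-03-03366-X, arXiv:1006.1002
[crux] the witness language L = {enc(A,B) : (A,B) ∈ height family ∧ #Sel₂(E_{A,B}/ℚ) ≤ 2} (enc =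
encodeNat ∘ Encodable.encode on ℤ × ℤ) is in the tree's strict BQP: validate (A,B) (p⁴ ∣ A ∧ p⁶ ∣ B
test via factoring ∈ FBQP), factor Δ (Shor) to get the bad primes S, compute E(ℚ)[2], the S-unit
group and the 2-torsion of the S-class group of K = ℚ[x]/(x³+Ax+B) (quantum: Hallgren 2005 constant
degree / Biasse–Song), then Sel₂ = {θ ∈ K(S,2) : N(θ) ∈ ℚ*², local conditions at S ∪ {2, ∞}} by
linear algebra over 𝔽₂ (Cassels/Simon 2-descent), and read dim Sel₂ ≤ 1. [difficulty: XL] -/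
@[route_item "route-QuantumAdvantage-SelmerBand", crux]
def SelmerMemBQP : Prop :=
  let P : ℤ × ℤ → Prop := fun AB => Nat.card ((Literature.NumberTheory.EllipticCurves.shortWeierstrass AB).selmerGroup 2) ≤ 2; let enc : ℤ × ℤ → List Bool := fun AB => Computability.encodeNat (Encodable.encode AB); let L : Language Bool := enc '' {AB | Literature.NumberTheory.EllipticCurves.IsInHeightFamily AB ∧ P AB}; L ∈ Literature.Computability.Cryptography.BQP

/-- item stmt-QuantumAdvantage-17068 · crux · rank 4 · open · by planner
why it might fail: False if a PPT beats the constant rule by 5 %: a class-group-free 2-descent, a poly-time L-value/modular-symbol method, or — under Poonen–Rains — a PPT emulating the root number of random E_(A,B) to ≈97 % (a w-ORACLE gains ≈8 %), which needs factoring-grade parity data (Rohrlich + Dokchitser).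
sources: arXiv:1009.0287, arXiv:1006.1002, arXiv:math/0610290, Literature.Barriers.QuantumAdvantage.SeparationPrerequisites
[crux] HYPOTHESIS-TYPE CRUX (conjecture-grade; summit strength by SeparationPrerequisites; refuters
first, never a proving target; ranked last): for every probabilistic polynomial-time A (tree
RandAlg, IsPolyTime) there are infinitely many X at which A's average probability, over the curves
of naive height < X, of correctly predicting "enc(A,B) ∈ L" is at most max(π_X, 1 − π_X) + 1/20, π_X
the proportion with #Sel₂ ≤ 2 — no efficient statistic beats the constant rule by five percent.
Typable relative to the prior because PriorBand is a theorem; 1/20 is the weakest margin the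
certified band allows (anything below 1/15 − 1/100). [deps: PriorBand] [difficulty: open-problem] -/
@[route_item "route-QuantumAdvantage-SelmerBand", crux]
def BeyondConstant : Prop :=
  let P : ℤ × ℤ → Prop := fun AB => Nat.card ((Literature.NumberTheory.EllipticCurves.shortWeierstrass AB).selmerGroup 2) ≤ 2; let enc : ℤ × ℤ → List Bool := fun AB => Computability.encodeNat (Encodable.encode AB); let L : Language Bool := enc '' {AB | Literature.NumberTheory.EllipticCurves.IsInHeightFamily AB ∧ P AB}; ∀ A : Literature.Computability.Complexity.RandAlg (List Bool) Bool, A.IsPolyTime id Computability.encodeBool → ∃ᶠ X : ℕ in Filter.atTop, (∑ AB ∈ Literature.NumberTheory.EllipticCurves.heightFamilyBelow X, A.pr id (enc AB) {Set.boolIndicator L (enc AB)}) / ((Literature.NumberTheory.EllipticCurves.heightFamilyBelow X).card : ℝ) ≤ max (Literature.NumberTheory.EllipticCurves.heightProportion P X) (1 - Literature.NumberTheory.EllipticCurves.heightProportion P X) + 1 / 20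

/-- item stmt-QuantumAdvantage-17069 · support · rank 9 · closed · proved by Summit.QuantumAdvantage.QuantumAdvantage.Theorems.SelmerBand.bandLower_proof @ 430892159c8e (prover) · by planner
sources: arXiv:1006.1002, Literature.NumberTheory.EllipticCurves.heightAverageLE_card_selmerTwo_holds
[support] the Markov half of the band, PROVABLE NOW and in fact PROVED in the planner's Sketch.lean
(`bandLower_proof`, kernel-closed): from the tree's `heightAverageLE_card_selmerTwo_holds` (limsup
of the average of #Sel₂ ≤ 3) and #Sel₂ = 2^s on the family (`exists_natCard_selmerGroup_eq_pow`),
the lower density of {#Sel₂ ≤ 2} is ≥ 1/3 (4 − 3·1_{≤2} ≤ #Sel₂ pointwise). [difficulty: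
provable-now] -/
@[route_item "route-QuantumAdvantage-SelmerBand"]
def BandLower : Prop :=
  Literature.NumberTheory.EllipticCurves.HeightDensityGE (fun AB : ℤ × ℤ => Nat.card ((Literature.NumberTheory.EllipticCurves.shortWeierstrass AB).selmerGroup 2) ≤ 2) (1 / 3)

-- `BandLower` holds: proved by `Summit.QuantumAdvantage.QuantumAdvantage.Theorems.SelmerBand.bandLower_proof` @ 430892159c8e (its module imports this route file, so no `_holds` link can be stated here).

/-- item stmt-QuantumAdvantage-17070 · support · rank 9 · open · by planner
sources: arXiv:1006.1002, Literature.NumberTheory.EllipticCurves.average_card_selmerTwo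
[support] NAMED-FACT-TYPE (Bhargava–Shankar, Ann. of Math. 181 (2015), Thm 1.1, the liminf half "the
average IS 3", via the uniformity estimate Thm 2.13; the tree's named fact `average_card_selmerTwo`
in Tendsto form implies it): for every ε > 0, eventually the height-average of #Sel₂ is ≥ 3 − ε.
[difficulty: L] -/
@[route_item "route-QuantumAdvantage-SelmerBand"]
def AverageGE : Prop :=
  ∀ ε : ℝ, 0 < ε → ∀ᶠ X : ℕ in Filter.atTop, 3 - ε ≤ Literature.NumberTheory.EllipticCurves.heightAverage (fun AB : ℤ × ℤ => (Nat.card ((Literature.NumberTheory.EllipticCurves.shortWeierstrass AB).selmerGroup 2) : ℝ)) X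

/-- item stmt-QuantumAdvantage-17071 · support · rank 9 · open · by planner
sources: arXiv:2110.09063
[support] NAMED-FACT-TYPE (Bhargava–Shankar–Swaminathan, arXiv:2110.09063, Thm 1.1, READ: "the
second moment of the size of the 2-Selmer group is at most 15", same family and height): limsup of
the height-average of (#Sel₂)² is ≤ 15, in the tree's HeightAverageLE form. [difficulty: L] -/
@[route_item "route-QuantumAdvantage-SelmerBand"]
def SecondMomentLE : Prop :=
  Literature.NumberTheory.EllipticCurves.HeightAverageLE (fun AB : ℤ × ℤ => ((Nat.card ((Literature.NumberTheory.EllipticCurves.shortWeierstrass AB).selmerGroup 2) : ℝ)) ^ 2) 15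

/-- item stmt-QuantumAdvantage-17072 · support · rank 9 · closed · proved by Summit.QuantumAdvantage.QuantumAdvantage.Theorems.SelmerBand.bandUpper_proof @ 090bd9aa5b7b (prover) · by planner
sources: arXiv:2110.09063, arXiv:1006.1002
[support] the Cauchy–Schwarz half, PROVABLE NOW (finite sums): AverageGE and SecondMomentLE give
lower density ≥ 1/15 for {#Sel₂ ≥ 4} = {¬ #Sel₂ ≤ 2}: with q = proportion of #Sel₂ ≥ 4,
avg(#Sel₂·1_{≥4}) ≥ (3 − ε) − 2 and (avg(#Sel₂·1_{≥4}))² ≤ avg(#Sel₂²)·q ≤ (15 + ε) q. [difficulty: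
provable-now] -/
@[route_item "route-QuantumAdvantage-SelmerBand"]
def BandUpper : Prop :=
  (∀ ε : ℝ, 0 < ε → ∀ᶠ X : ℕ in Filter.atTop, 3 - ε ≤ Literature.NumberTheory.EllipticCurves.heightAverage (fun AB : ℤ × ℤ => (Nat.card ((Literature.NumberTheory.EllipticCurves.shortWeierstrass AB).selmerGroup 2) : ℝ)) X) → Literature.NumberTheory.EllipticCurves.HeightAverageLE (fun AB : ℤ × ℤ => ((Nat.card ((Literature.NumberTheory.EllipticCurves.shortWeierstrass AB).selmerGroup 2) : ℝ)) ^ 2) 15 → Literature.NumberTheory.EllipticCurves.HeightDensityGE (fun AB : ℤ × ℤ => ¬ (Nat.card ((Literature.NumberTheory.EllipticCurves.shortWeierstrass AB).selmerGroup 2) ≤ 2)) (1 / 15)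

-- `BandUpper` holds: proved by `Summit.QuantumAdvantage.QuantumAdvantage.Theorems.SelmerBand.bandUpper_proof` @ 090bd9aa5b7b (its module imports this route file, so no `_holds` link can be stated here).

/-- item stmt-QuantumAdvantage-17073 · support · rank 9 · closed · proved by Summit.QuantumAdvantage.QuantumAdvantage.Theorems.SelmerBand.bandGlue_proof @ 7345556edd45 (prover) · by planner
sources: arXiv:1006.1002
[support] glue of the band, PROVABLE NOW: HeightDensityGE P (1/3) and HeightDensityGE ¬P (1/15) give
PriorBand (the two proportions sum to 1 on a nonempty family; take ε = 1/100). [difficulty: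
provable-now] -/
@[route_item "route-QuantumAdvantage-SelmerBand"]
def BandGlue : Prop :=
  let P : ℤ × ℤ → Prop := fun AB => Nat.card ((Literature.NumberTheory.EllipticCurves.shortWeierstrass AB).selmerGroup 2) ≤ 2; Literature.NumberTheory.EllipticCurves.HeightDensityGE P (1 / 3) → Literature.NumberTheory.EllipticCurves.HeightDensityGE (fun AB => ¬ P AB) (1 / 15) → ∀ᶠ X : ℕ in Filter.atTop, (1 : ℝ) / 3 - 1 / 100 ≤ Literature.NumberTheory.EllipticCurves.heightProportion P X ∧ Literature.NumberTheory.EllipticCurves.heightProportion P X ≤ 14 / 15 + 1 / 100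

-- `BandGlue` holds: proved by `Summit.QuantumAdvantage.QuantumAdvantage.Theorems.SelmerBand.bandGlue_proof` @ 7345556edd45 (its module imports this route file, so no `_holds` link can be stated here).

/-- item stmt-QuantumAdvantage-17075 · assembly · rank 1 · closed · proved by Summit.QuantumAdvantage.QuantumAdvantage.Theorems.SelmerBand.Assembly_proof @ 53037de5bb06 (prover) · by planner
sources: arXiv:1006.1002, doi:10.1145/1060590.1060660
[assembly] PriorBand → SelmerMemBQP → BeyondConstant → QuantumAdvantage -/
@[route_item "route-QuantumAdvantage-SelmerBand"]
def Assembly : Prop :=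
  PriorBand → SelmerMemBQP → BeyondConstant → QuantumAdvantage

-- `Assembly` holds: proved by `Summit.QuantumAdvantage.QuantumAdvantage.Theorems.SelmerBand.Assembly_proof` @ 53037de5bb06 (its module imports this route file, so no `_holds` link can be stated here).

/-! D-0027 §2.1 — DECIDING THEOREM (planner-authored via `route open/edit --closes-file`; by planner-plan-novel-QuantumAdvantage-QuantumAdva-e0108269-b-v 2026-08-16T22:23:19Z):
its hypotheses are this route's items and its conclusion the sub-problem Statement (glue_lint), and it elaborates with this file. -/

@[closes "route-QuantumAdvantage-SelmerBand"] theorem closes (hBand : PriorBand) (hMem : SelmerMemBQP) (hHyp : BeyondConstant) : QuantumAdvantage := by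
  classical
  set P : ℤ × ℤ → Prop := fun AB => Nat.card ((Literature.NumberTheory.EllipticCurves.shortWeierstrass AB).selmerGroup 2) ≤ 2 with hP
  set enc : ℤ × ℤ → List Bool := fun AB => Computability.encodeNat (Encodable.encode AB) with henc
  set L : Language Bool := enc '' {AB | Literature.NumberTheory.EllipticCurves.IsInHeightFamily AB ∧ P AB} with hL
  refine ⟨L, hMem, ?_⟩
  intro hBPP
  -- BPP error reduction to 1/200 (tree: Arora–Barak Thm 7.10, discharged)
  obtain ⟨A, hApoly, -, hAcorrect⟩ :=
    Literature.Computability.Complexity.exists_randAlg_error_le_of_mem_BPP_holds hBPP (1 / 200) (by norm_num)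
  have hfreq := hHyp A hApoly
  -- a level X where the hypothesis bound, the band and X ≥ 5 hold together
  obtain ⟨X, hX1, hX2⟩ := (hfreq.and_eventually (hBand.and (Filter.eventually_ge_atTop 5))).exists
  obtain ⟨⟨hlow, hhigh⟩, hX5⟩ := hX2
  -- the family below X is nonempty for X ≥ 5: (A, B) = (1, 0) has naive height 4
  have hmem : ((1 : ℤ), (0 : ℤ)) ∈ Literature.NumberTheory.EllipticCurves.heightFamilyBelow X := by
    rw [Literature.NumberTheory.EllipticCurves.mem_heightFamilyBelow_iff]
    refine ⟨⟨by norm_num, ?_⟩, ?_⟩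
    · rintro p hp ⟨h4, _⟩
      have h1 : (p : ℤ) ^ 4 ∣ 1 := h4
      have hle := Int.le_of_dvd one_pos h1
      have hp2 : (2 : ℤ) ≤ p := by exact_mod_cast hp.two_le
      have hpow : (2 : ℤ) ^ 4 ≤ (p : ℤ) ^ 4 := pow_le_pow_left₀ (by norm_num) hp2 4
      norm_num at hpow
      omega
    · have h5 : (5 : ℤ) ≤ (X : ℤ) := by exact_mod_cast hX5
      show max (4 * |(1 : ℤ)| ^ 3) (27 * (0 : ℤ) ^ 2) < (X : ℤ)
      norm_num
      omega
  have hcard_pos : (0 : ℝ) < ((Literature.NumberTheory.EllipticCurves.heightFamilyBelow X).card : ℝ) := by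
    exact_mod_cast Finset.card_pos.mpr ⟨_, hmem⟩
  -- the amplified BPP decider succeeds on average with probability ≥ 1 - 1/200
  have havg : 1 - (1 : ℝ) / 200 ≤ (∑ AB ∈ Literature.NumberTheory.EllipticCurves.heightFamilyBelow X, A.pr id (enc AB) {Set.boolIndicator L (enc AB)}) / ((Literature.NumberTheory.EllipticCurves.heightFamilyBelow X).card : ℝ) := by
    rw [le_div_iff₀ hcard_pos]
    have hsum : ∑ AB ∈ Literature.NumberTheory.EllipticCurves.heightFamilyBelow X, (1 - (1 : ℝ) / 200) ≤ ∑ AB ∈ Literature.NumberTheory.EllipticCurves.heightFamilyBelow X, A.pr id (enc AB) {Set.boolIndicator L (enc AB)} :=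
      Finset.sum_le_sum fun AB _ => hAcorrect (enc AB)
    rw [Finset.sum_const, nsmul_eq_mul] at hsum
    linarith
  -- the band caps the constant rule at 14/15 + 1/100
  have hmax : max (Literature.NumberTheory.EllipticCurves.heightProportion P X) (1 - Literature.NumberTheory.EllipticCurves.heightProportion P X) ≤ 14 / 15 + 1 / 100 := by
    apply max_le hhigh
    linarith
  have hfin : (∑ AB ∈ Literature.NumberTheory.EllipticCurves.heightFamilyBelow X, A.pr id (enc AB) {Set.boolIndicator L (enc AB)}) / ((Literature.NumberTheory.EllipticCurves.heightFamilyBelow X).card : ℝ) ≤ max (Literature.NumberTheory.EllipticCurves.heightProportion P X) (1 - Literature.NumberTheory.EllipticCurves.heightProportion P X) + 1 / 20 := hX1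
  linarith

end Summit.QuantumAdvantage.QuantumAdvantage.Theses.SelmerBand
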